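import Literature.Probability.LatticeModels.HoleFreePotential
import Literature.Probability.RandomPlanarGeometry.ChordalLERWScalingLimit
import HarnessLib

/-!
# Hole-filling a set of lattice sites: the outer approximant is hole-free and stays in its box
— helper of stub `stub_greenConvergence` (GC) of line `symplectic-fermion-anchor`
(crux `SAWLoopFugacityFlow.AvoidanceLimit`, stmt-CriticalPhenomena-10649; lead c2 GC-sandwich
programme, brick W-E: pure `ℤ²` combinatorics, no analysis)

**What.** For a set of sites `V ⊆ ℤ²`, say that a site `g` *escapes* (from `V`) when for every
height `M` there is a chain of face steps avoiding `V` (`FaceStep V`: nearest-neighbour steps of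
`ℤ²` with both endpoints outside `V`) from `g` to a site of second coordinate `≥ M`; the
*hole-fill* `NE V = {g | g does not escape}` is `V` together with everything `V` encloses. We prove
the three registered signatures of brick W-E:

* `subset_nonEscaping`: `V ⊆ NE V` (a chain of face steps issued from a point of `V` is trivial,
  so it never exceeds its own height);
* `holeFree_nonEscaping_component`: for every base point `b`, the set of sites reachable from `b`
  in the nearest-neighbour graph `ChordalLERW.siteGraph (NE V)` (all edges of `ℤ²` with both
  endpoints in `NE V`) is hole-free (`HoleFree`,
  `Literature/Probability/LatticeModels/HoleFreePotential`);
* `nonEscaping_subset_box`: if `V` lies in the box `{|x₀| ≤ N, |x₁| ≤ N}` then so does `NE V`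
  (a site outside the box escapes: straight up, or — when it lies below the box — first east
  past the box and then up).

**Proof of hole-freeness.** Escaping is invariant along chains of face steps avoiding `V` (chains
are reversible: go back, then up), so an escaping site escapes through escaping sites, i.e. its
chains avoid every set of non-escaping sites (`faceChain_of_escaping`). If `b ∉ NE V` the
reachable set is `{b}`, and a singleton is hole-free (climb, after one step east if `b` lies
straight above). If `b ∈ NE V` the reachable set `C` lies in `NE V`; let `g ∉ C`, `M ∈ ℤ`, and let
`R` be the set of sites reached from `g` by face steps avoiding `C`. If `R` contains an escaping
site we continue through `FaceStep (NE V)`, a fortiori through `FaceStep C`. Otherwise `R ⊆ NE V`;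
if the heights of `R` were bounded by `M`, a site `x ∈ R` of maximal height would have its upper
neighbour `y ∉ R`, so the step `x → y` is not a face step avoiding `C`, so `y ∈ C ⊆ NE V`; then
`x ∼ y` in `siteGraph (NE V)` and `x ∈ C` — absurd (`holeFree_of_escape_of_up`, the same
maximal-height argument as brick W-C2).

Sources: folklore lattice combinatorics; no definitions, nothing asserted from the literature. The
straight runs `faceChain_up` / `faceChain_east` and the box escape are adapted from
`Literature/Probability/LatticeModels/BoundaryPoleGreenBounds` (`reflTransGen_faceStep_up`,
`reflTransGen_faceStep_east`, `holeFree_sqBox`; not in the import cone of this file).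
-/

noncomputable section

open scoped BigOperators Topology
open Filter Finset
open Literature.Probability.RandomPlanarGeometry Literature.Probability.LatticeModels

namespace Summit.CriticalPhenomena.SAWScalingLimit.Theorems.AvoidanceLimit.Anchor

/-! ## Chains of face steps -/

/-- Face steps avoiding `P` are reversible. [folklore] -/
private theorem faceStep_symm {P : Set (Site 2)} {a a' : Site 2} (h : FaceStep P a a') :
    FaceStep P a' a :=
  ⟨h.1.symm, h.2.2, h.2.1⟩

/-- Chains of face steps avoiding `P` are reversible. [folklore] -/
private theorem faceChain_symm {P : Set (Site 2)} {a a' : Site 2}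
    (h : Relation.ReflTransGen (FaceStep P) a a') : Relation.ReflTransGen (FaceStep P) a' a := by
  induction h with
  | refl => exact Relation.ReflTransGen.refl
  | tail _ hbc ih => exact Relation.ReflTransGen.head (faceStep_symm hbc) ih

/-- A chain of face steps avoiding `P` that starts outside `P` ends outside `P`. [folklore] -/
private theorem notMem_of_faceChain {P : Set (Site 2)} {g y : Site 2}
    (h : Relation.ReflTransGen (FaceStep P) g y) (hg : g ∉ P) : y ∉ P := by
  induction h with
  | refl => exact hg
  | tail _ hs _ => exact hs.2.2

/-- A chain of face steps avoiding `P` issued from a point of `P` is trivial. [folklore] -/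
private theorem eq_of_faceChain_of_mem {P : Set (Site 2)} {g y : Site 2}
    (h : Relation.ReflTransGen (FaceStep P) g y) (hg : g ∈ P) : y = g := by
  rcases h.cases_head with rfl | ⟨c, hc, -⟩
  · rfl
  · exact absurd hg hc.2.1

/-- `v` is adjacent in `ℤ²` to `v + cornerUnit k`. [folklore] -/
private theorem zd_adj_add_cornerUnit (v : Site 2) (k : Fin 4) :
    (zdGraph 2).Adj v (v + cornerUnit k) :=
  (SimpleGraph.mem_edgeSet _).1 (cSrc_mem_edgeSet (v, k))

/-- Coordinates of the eastern and northern neighbours of `v`. [folklore] -/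
private theorem add_cornerUnit_apply' (v : Site 2) :
    ((v + cornerUnit 0) 0 = v 0 + 1 ∧ (v + cornerUnit 0) 1 = v 1) ∧
    ((v + cornerUnit 1) 0 = v 0 ∧ (v + cornerUnit 1) 1 = v 1 + 1) := by
  simp [Pi.add_apply]

/-- Two sites of `ℤ²` with the same coordinates are equal. [folklore] -/
private theorem site_eq_of_apply {x y : Site 2} (h0 : x 0 = y 0) (h1 : x 1 = y 1) : x = y :=
  funext (Fin.forall_fin_two.2 ⟨h0, h1⟩)

/-- Coordinates along an eastward run: `(s + k e₀) 0 = s 0 + k`, `(s + k e₀) 1 = s 1`. [folklore] -/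
private theorem nsmul_cornerUnit_zero_apply (s : Site 2) (k : ℕ) :
    (s + k • cornerUnit 0) 0 = s 0 + k ∧ (s + k • cornerUnit 0) 1 = s 1 := by
  simp [Pi.add_apply]

/-- A straight run of face steps outside `P`: upwards. [folklore] -/
private theorem faceChain_up {P : Set (Site 2)} {g : Site 2} {K : ℕ}
    (h : ∀ j : ℕ, j ≤ K → g + j • cornerUnit 1 ∉ P) :
    Relation.ReflTransGen (FaceStep P) g (g + K • cornerUnit 1) := by
  -- adapted from `Literature.Probability.LatticeModels.reflTransGen_faceStep_up`
  -- (`BoundaryPoleGreenBounds`)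
  induction K with
  | zero => rw [zero_nsmul, add_zero]
  | succ K ih =>
    refine (ih fun j hj => h j (by omega)).tail ⟨?_, h K (by omega), ?_⟩
    · rw [succ_nsmul, ← add_assoc]
      exact zd_adj_add_cornerUnit (g + K • cornerUnit 1) 1
    · exact h (K + 1) le_rfl

/-- A straight run of face steps outside `P`: eastwards. [folklore] -/
private theorem faceChain_east {P : Set (Site 2)} {g : Site 2} {K : ℕ}
    (h : ∀ j : ℕ, j ≤ K → g + j • cornerUnit 0 ∉ P) :
    Relation.ReflTransGen (FaceStep P) g (g + K • cornerUnit 0) := by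
  -- adapted from `Literature.Probability.LatticeModels.reflTransGen_faceStep_east`
  -- (`BoundaryPoleGreenBounds`)
  induction K with
  | zero => rw [zero_nsmul, add_zero]
  | succ K ih =>
    refine (ih fun j hj => h j (by omega)).tail ⟨?_, h K (by omega), ?_⟩
    · rw [succ_nsmul, ← add_assoc]
      exact zd_adj_add_cornerUnit (g + K • cornerUnit 0) 0
    · exact h (K + 1) le_rfl

/-- A site whose upward column (itself included) avoids `P` is joined to sites of every height by
face steps avoiding `P`. [folklore] -/
private theorem exists_faceChain_of_column {P : Set (Site 2)} {g : Site 2}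
    (h : ∀ j : ℕ, g + j • cornerUnit 1 ∉ P) (M : ℤ) :
    ∃ g' : Site 2, M ≤ g' 1 ∧ Relation.ReflTransGen (FaceStep P) g g' := by
  obtain ⟨K, hK⟩ : ∃ K : ℕ, M ≤ g 1 + K := ⟨(M - g 1).toNat, by omega⟩
  exact ⟨g + K • cornerUnit 1, by rw [(nsmul_cornerUnit_one_apply g K).2]; exact hK,
    faceChain_up fun j _ => h j⟩

/-- **A singleton is hole-free**: a site `g ≠ b` climbs straight up, after one step east when `b`
lies on the column strictly above `g`. [folklore] -/
private theorem holeFree_singleton (b : Site 2) : HoleFree ({b} : Set (Site 2)) := by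
  intro g hg M
  have hgb : ¬ (g 0 = b 0 ∧ g 1 = b 1) :=
    fun h => hg (Set.mem_singleton_iff.2 (site_eq_of_apply h.1 h.2))
  by_cases hcol : b 0 = g 0 ∧ g 1 < b 1
  · -- one step east, then up the column `g 0 + 1 ≠ b 0`
    obtain ⟨hb0, -⟩ := hcol
    obtain ⟨e0, -⟩ := (add_cornerUnit_apply' g).1
    have hstep : FaceStep {b} g (g + cornerUnit 0) := by
      refine ⟨zd_adj_add_cornerUnit g 0, hg, fun hmem => ?_⟩
      have h0 := congrFun (Set.mem_singleton_iff.1 hmem) 0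
      omega
    obtain ⟨g', hM, hpath⟩ := exists_faceChain_of_column (P := {b}) (g := g + cornerUnit 0)
      (fun j hmem => by
        have h0 := congrFun (Set.mem_singleton_iff.1 hmem) 0
        rw [(nsmul_cornerUnit_one_apply _ j).1] at h0
        omega) M
    exact ⟨g', hM, Relation.ReflTransGen.head hstep hpath⟩
  · -- straight up: the column above `g` misses `b`
    refine exists_faceChain_of_column (fun j hmem => ?_) M
    have heq : g + j • cornerUnit 1 = b := Set.mem_singleton_iff.1 hmem
    have h0 := congrFun heq 0
    have h1 := congrFun heq 1
    rw [(nsmul_cornerUnit_one_apply g j).1] at h0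
    rw [(nsmul_cornerUnit_one_apply g j).2] at h1
    have hle : b 1 ≤ g 1 := not_lt.1 fun hlt => hcol ⟨h0.symm, hlt⟩
    have hne : g 1 ≠ b 1 := fun h => hgb ⟨h0, h⟩
    omega

/-! ## Hole-freeness from the escape property -/

/-- **Hole-freeness from escape and upward closure.** Let `C ⊆ A ⊆ ℤ²`. Suppose that every site
outside `A` is joined by face steps avoiding `A` to sites of every height, and that a site of `A`
whose upper neighbour lies in `C` lies in `C`. Then `C` is hole-free: from `g ∉ C`, either the sites
reached by face steps avoiding `C` contain one outside `A` (continue through face steps avoiding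
`A ⊇ C`), or they all lie in `A`, and then they are unbounded in height — else the upper neighbour
`y` of one of them of maximal height, `x`, is not reached, so `y ∈ C`, so `x ∈ C`, absurd.
[folklore] -/
private theorem holeFree_of_escape_of_up {A C : Set (Site 2)} (hCA : C ⊆ A)
    (hesc : ∀ x : Site 2, x ∉ A → ∀ M : ℤ, ∃ g' : Site 2, M ≤ g' 1 ∧
      Relation.ReflTransGen (FaceStep A) x g')
    (hup : ∀ x : Site 2, x ∈ A → x + cornerUnit 1 ∈ C → x ∈ C) : HoleFree C := by
  -- the maximal-height argument of brick W-C2 (`holeFree_innerComponent`)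
  intro g hg M
  by_cases hall : ∀ y : Site 2, Relation.ReflTransGen (FaceStep C) g y → y ∈ A
  · -- every site reached from `g` lies in `A`: the reached set is unbounded in height
    by_contra hcon
    push Not at hcon
    have hbd : ∀ y : Site 2, Relation.ReflTransGen (FaceStep C) g y → y 1 ≤ M :=
      fun y hyR => le_of_lt (not_le.1 fun hle => hcon y hle hyR)
    obtain ⟨h₀, ⟨x, hxR, hxh⟩, hmax⟩ := Int.exists_greatest_of_bdd
      (P := fun h : ℤ => ∃ y : Site 2, Relation.ReflTransGen (FaceStep C) g y ∧ y 1 = h)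
      ⟨M, fun h ⟨y, hyR, hyh⟩ => hyh ▸ hbd y hyR⟩ ⟨g 1, g, Relation.ReflTransGen.refl, rfl⟩
    have hxC : x ∉ C := notMem_of_faceChain hxR hg
    have hyC : x + cornerUnit 1 ∈ C := by
      by_contra hyC
      have h1 := hmax _ ⟨x + cornerUnit 1, hxR.tail ⟨zd_adj_add_cornerUnit x 1, hxC, hyC⟩, rfl⟩
      rw [(add_cornerUnit_apply' x).2.2] at h1
      omega
    exact hxC (hup x (hall x hxR) hyC)
  · -- some site reached from `g` lies outside `A`: continue through face steps avoiding `A`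
    push Not at hall
    obtain ⟨x, hxR, hxA⟩ := hall
    obtain ⟨g', hM, hpath⟩ := hesc x hxA M
    exact ⟨g', hM, hxR.trans
      (Relation.ReflTransGen.mono (fun a a' h => FaceStep.mono hCA h) _ _ hpath)⟩

/-- Escaping from `V` is invariant along chains of face steps avoiding `V`: go back along the
(reversible) chain, then up. [folklore] -/
private theorem escaping_of_faceChain {V : Set (Site 2)} {g h : Site 2}
    (hg : ∀ M : ℤ, ∃ g' : Site 2, M ≤ g' 1 ∧ Relation.ReflTransGen (FaceStep V) g g')
    (hgh : Relation.ReflTransGen (FaceStep V) g h) (M : ℤ) :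
    ∃ g' : Site 2, M ≤ g' 1 ∧ Relation.ReflTransGen (FaceStep V) h g' := by
  obtain ⟨g', hM, hpath⟩ := hg M
  exact ⟨g', hM, (faceChain_symm hgh).trans hpath⟩

/-- **An escaping site escapes through escaping sites**: a chain of face steps avoiding `V` issued
from an escaping site consists of escaping sites, hence avoids every set `C` of non-escaping sites.
[folklore] -/
private theorem faceChain_of_escaping {V C : Set (Site 2)}
    (hC : ∀ x ∈ C, ¬ ∀ M : ℤ, ∃ g' : Site 2, M ≤ g' 1 ∧ Relation.ReflTransGen (FaceStep V) x g')
    {g : Site 2} (hg : ∀ M : ℤ, ∃ g' : Site 2, M ≤ g' 1 ∧ Relation.ReflTransGen (FaceStep V) g g')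
    {y : Site 2} (hpath : Relation.ReflTransGen (FaceStep V) g y) :
    Relation.ReflTransGen (FaceStep C) g y := by
  induction hpath with
  | refl => exact Relation.ReflTransGen.refl
  | tail hab hbc ih =>
    exact ih.tail ⟨hbc.1, fun hb => hC _ hb (escaping_of_faceChain hg hab),
      fun hc => hC _ hc (escaping_of_faceChain hg (hab.tail hbc))⟩

/-! ## Reachable sets of `siteGraph A` -/

/-- A site reachable in `siteGraph A` from a point of `A` lies in `A` (the last dart of a walk of
positive length ends in `A`). [folklore] -/
private theorem mem_of_reachable_siteGraph {A : Set (Site 2)} {b x : Site 2} (hb : b ∈ A)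
    (h : (ChordalLERW.siteGraph A).Reachable b x) : x ∈ A := by
  obtain ⟨w⟩ := h.symm
  cases w with
  | nil => exact hb
  | cons hadj _ => exact (ChordalLERW.siteGraph_adj_iff.1 hadj).2.1

/-- A point outside `A` is isolated in `siteGraph A`: its reachable set is the singleton.
[folklore] -/
private theorem setOf_reachable_siteGraph_eq_singleton {A : Set (Site 2)} {b : Site 2}
    (hb : b ∉ A) : {x : Site 2 | (ChordalLERW.siteGraph A).Reachable b x} = {b} := by
  ext x
  simp only [Set.mem_setOf_eq, Set.mem_singleton_iff]
  constructor
  · rintro ⟨w⟩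
    cases w with
    | nil => rfl
    | cons hadj _ => exact absurd (ChordalLERW.siteGraph_adj_iff.1 hadj).2.1 hb
  · rintro rfl
    exact ⟨SimpleGraph.Walk.nil⟩

/-- **Reachable sets of a set with the escape property are hole-free.** If every site outside `A`
is joined by face steps avoiding `A` to sites of every height, then for every base point `b` the
set of sites reachable from `b` in `siteGraph A` is hole-free: for `b ∈ A` by
`holeFree_of_escape_of_up` (a site of `A` below a reachable site is reachable), for `b ∉ A` it is
the singleton `{b}`. [folklore] -/
private theorem holeFree_setOf_reachable_siteGraph {A : Set (Site 2)}
    (hesc : ∀ x : Site 2, x ∉ A → ∀ M : ℤ, ∃ g' : Site 2, M ≤ g' 1 ∧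
      Relation.ReflTransGen (FaceStep A) x g')
    (b : Site 2) : HoleFree {x : Site 2 | (ChordalLERW.siteGraph A).Reachable b x} := by
  by_cases hb : b ∈ A
  · refine holeFree_of_escape_of_up (fun x hx => mem_of_reachable_siteGraph hb hx) hesc ?_
    intro x hxA hyC
    have hyC' : (ChordalLERW.siteGraph A).Reachable b (x + cornerUnit 1) := hyC
    have hyA : x + cornerUnit 1 ∈ A := mem_of_reachable_siteGraph hb hyC'
    exact hyC'.trans
      (ChordalLERW.siteGraph_adj_iff.2 ⟨(zd_adj_add_cornerUnit x 1).symm, hyA, hxA⟩).reachable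
  · rw [setOf_reachable_siteGraph_eq_singleton hb]
    exact holeFree_singleton b

/-! ## The three registered statements -/

/-- **`V` lies in its hole-fill** (registered signature, GC-sandwich brick W-E): no point of `V`
escapes from `V`, since a chain of face steps avoiding `V` issued from a point `v ∈ V` is trivial
and so never reaches height `v 1 + 1`. [folklore] -/
theorem subset_nonEscaping :
    ∀ (V : Set (Site 2)), V ⊆ {g : Site 2 | ¬ ∀ M : ℤ, ∃ g' : Site 2, M ≤ g' 1 ∧
      Relation.ReflTransGen (FaceStep V) g g'} := by
  intro V v hv hesc
  obtain ⟨g', hM, hpath⟩ := hesc (v 1 + 1)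
  rw [eq_of_faceChain_of_mem hpath hv] at hM
  omega

/-- **The reachable sets of the hole-fill are hole-free** (registered signature, GC-sandwich brick
W-E). With `NE V = {g | g does not escape from V}` and any base point `b`, the set of sites
reachable from `b` in `siteGraph (NE V)` is hole-free: an escaping site escapes through escaping
sites (`faceChain_of_escaping`), which is the escape property of `NE V` required by
`holeFree_setOf_reachable_siteGraph`. [folklore] -/
theorem holeFree_nonEscaping_component :
    ∀ (V : Set (Site 2)) (b : Site 2),
      HoleFree {x : Site 2 | (ChordalLERW.siteGraph {g : Site 2 | ¬ ∀ M : ℤ, ∃ g' : Site 2, M ≤ g' 1 ∧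
        Relation.ReflTransGen (FaceStep V) g g'}).Reachable b x} := by
  intro V b
  refine holeFree_setOf_reachable_siteGraph (fun x hx M => ?_) b
  have hx' : ∀ M : ℤ, ∃ g' : Site 2, M ≤ g' 1 ∧ Relation.ReflTransGen (FaceStep V) x g' :=
    not_not.1 hx
  obtain ⟨g', hM, hpath⟩ := hx' M
  exact ⟨g', hM, faceChain_of_escaping (fun y hy => hy) hx' hpath⟩

/-- **The hole-fill of a set in a box stays in the box** (registered signature, GC-sandwich brick
W-E): if every `v ∈ V` has `|v 0| ≤ N` and `|v 1| ≤ N`, then so does every non-escaping site.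
Contrapositive: a site outside the box escapes from `V` — if its column misses the box or it lies
above the box it climbs straight up; if it lies below the box it first runs east past the box
(at a height below `-N`, outside `V`) and then climbs. [folklore] -/
theorem nonEscaping_subset_box :
    ∀ (V : Set (Site 2)) (N : ℕ), (∀ v ∈ V, |v 0| ≤ N ∧ |v 1| ≤ N) →
      {g : Site 2 | ¬ ∀ M : ℤ, ∃ g' : Site 2, M ≤ g' 1 ∧ Relation.ReflTransGen (FaceStep V) g g'} ⊆
        {g : Site 2 | |g 0| ≤ N ∧ |g 1| ≤ N} := by
  -- adapted from `Literature.Probability.LatticeModels.holeFree_sqBox` (`BoundaryPoleGreenBounds`)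
  intro V N hV g hg
  by_contra hbox
  refine absurd (fun M => ?_) hg
  simp only [Set.mem_setOf_eq, not_and_or, not_le] at hbox
  -- a site whose column misses the box, or which lies above the box, climbs straight up
  have climb : ∀ g' : Site 2, ((N : ℤ) < |g' 0| ∨ (N : ℤ) < g' 1) →
      ∃ g'' : Site 2, M ≤ g'' 1 ∧ Relation.ReflTransGen (FaceStep V) g' g'' := by
    intro g' hg'
    refine exists_faceChain_of_column (fun j hmem => ?_) M
    obtain ⟨h0, h1⟩ := hV _ hmem
    rw [(nsmul_cornerUnit_one_apply g' j).1] at h0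
    rw [(nsmul_cornerUnit_one_apply g' j).2, abs_le] at h1
    rcases hg' with hg' | hg'
    · exact absurd h0 (not_le.2 hg')
    · omega
  rcases hbox with hg0 | hg1
  · exact climb g (Or.inl hg0)
  · rw [lt_abs] at hg1
    rcases hg1 with hup | hdown
    · exact climb g (Or.inr hup)
    · -- below the box: run east past it, then climb
      obtain ⟨K, hK⟩ : ∃ K : ℕ, (N : ℤ) < g 0 + K := ⟨(N + 1 - g 0).toNat, by omega⟩
      have hrun : Relation.ReflTransGen (FaceStep V) g (g + K • cornerUnit 0) := by
        refine faceChain_east fun j _ hmem => ?_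
        obtain ⟨-, h1⟩ := hV _ hmem
        rw [(nsmul_cornerUnit_zero_apply g j).2, abs_le] at h1
        omega
      obtain ⟨g'', hM, hpath⟩ := climb (g + K • cornerUnit 0) (Or.inl (by
        rw [(nsmul_cornerUnit_zero_apply g K).1, lt_abs]; exact Or.inl hK))
      exact ⟨g'', hM, hrun.trans hpath⟩

end Summit.CriticalPhenomena.SAWScalingLimit.Theorems.AvoidanceLimit.Anchor

end
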